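import Literature.NumberTheory.IwasawaTheory.ClassGroupPRankTwoLeOfCardFixedLayerTwoAlgebra
import Literature.NumberTheory.IwasawaTheory.ClassGroupPRankLeOneOfNonNormUnitLayerTwo
import HarnessLib

/-!
# The converse quadrant at `p = 2`: over a base with `2 ∤ h_K`, `4 ∣ h(K_1)` AND `4 ∣ #Cl(K_2)^{Gal(K_2/K)}` force `rank₂ Cl(K_2) ≥ 2`
# — no door of the «rank ≤ 1» family (Chevalley, depth, pro-cyclic) can fire when every unit of `K` is a norm from `K_2` and `e₁ ≥ 2`

Topic `NumberTheory/IwasawaTheory` (namespace = path).  THEOREM-ONLY file (no definition, no named fact, no instance, no `sorry`), written by the prover seat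
`bsd-line-att-p3` g46 (cell `bsd-f1-sign2`, route `AlignedTransportAtTwo`; `--supports` stmt-BirchSwinnertonDyer-22298, closes nothing; no class group is computed here).
Third panel of the layer-two triptych: the DEPTH DOOR (`ClassGroupPRankLeOneOfAmbiguousLayerTwo`, g42: `e₁ ≤ 1 ∧ 4 ∣ #Cl(K_2)^G ⟹ rank ≤ 1`), the PRO-CYCLIC DOOR
(`ClassGroupPRankLeOneOfCardFixedLeTwoLayerTwo`, this seat: `e₁ ≥ 2 ∧ 4 ∤ #Cl(K_2)^G ⟹ rank ≤ 1`), and HERE the remaining quadrant **`e₁ ≥ 2 ∧ 4 ∣ #Cl(K_2)^G ⟹ rank₂ Cl(K_2) ≥ 2`**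
— a TRIAGE theorem: on that class the Iwasawa module is not pro-cyclic (in `Λ`-terms `J` contains no `T − a`: `v₂(a) ≥ 2` would give `e₁ = v₂(2 + a) = 1`, `v₂(a) = 1` would give
`#X/TX = 2`; so `μ₂ > 0` or `λ₂ ≥ 2`), and the only finite-level decider left is `rank₂ Cl(K_2) ≤ 2` itself (door L10 at `j = 2`), a class-group rank of the degree-`4[K:ℚ]` layer.

BRICKS (companion `ClassGroupPRankTwoLeOfCardFixedLayerTwoAlgebra`): on a cyclic `2`-group every endomorphism `φ` has `#M/(φ−1)M ≤ 2` or `#M/(φ+1)M ≤ 2`;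
for a finite commutative group with `4 ∣ #G^α` and a surjection `N` onto a group of order divisible by `4` killing `g·αg` on `2`-primary `g`: `#G[2] ≥ 4`.  TOWER (as in the
pro-cyclic file, on `Cl(K_2)[2^∞]` with `σ = γ|_{K_2}`, the `Γ`-equivariant norm onto `Cl(K_1)` and Neukirch (1.6)(iv)): ★★ `two_le_classGroupPRank_two_of_two_le_of_four_dvd`.
CHEVALLEY (g42's `four_dvd_card_fixed_layer_two`: two ramified primes and `[E_K : E_K ∩ N_{K_2/K}K_2ˣ] = 1`): ★★ `two_le_classGroupPRank_two_of_relIndex_unitsNorm_eq_one{,_of_forall_odd_ramificationIdx}`.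

USE (cell bsd-f1-sign2, crux C2; complex cubic `F = ℚ(β)`, `Δ_W ≡ 5 (8)`, `t` the `2`-adic depth of `ε_F`): the class **`t ≥ 4 ∧ e₁ ≥ 2`** (seeds `1187`, `4307`, `14539`, `5747` of
the typed census) — the depth door needs `e₁ ≤ 1`, the pro-cyclic door needs `t ≤ 3`; this file says no rank-`≤ 1` conclusion is possible there at all.
HONEST SCOPE: classical; nothing specific to any summit; BSD is not advanced by this file.  Not found in print in this form; ingredients cited at each use (D-0014).

References: [Washington1997] §13.3 Lemmas 13.15, 13.18, Prop. 13.22; [Lang1990] Ch. 5 §2 (Weierstrass preparation), Ch. 13 §4 Lemma 4.1; [NeukirchANT1999] Ch. III §1 (1.6)(iv);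
[Fukuda1994] Thm. 1 (2), p. 264.
-/

set_option autoImplicit false

noncomputable section

open Finset NumberField IsDedekindDomain Field IntermediateField
open scoped NumberField

namespace Literature.NumberTheory.IwasawaTheory

/-! ## §3 The converse quadrant in the `ℤ₂`-tower over a base with `2 ∤ h_K` (Fukuda index `0`) -/

section Door

open Literature.NumberTheory.EllipticCurves Literature.NumberTheory.NumberFields
  Literature.NumberTheory.GaloisRepresentations

variable {K : Type} [Field K] [NumberField K]

/-- ★★ **THE CONVERSE QUADRANT (one layer).**  `κ` a `ℤ₂`-extension of the number field `K` with Fukuda index `0`, `2 ∤ h_K`, **`2 ≤ ord₂ h(K_1)`** and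
**`4 ∣ #{c ∈ Cl(K_2) : τc = c ∀ τ ∈ Gal(K_2/K)}`**.  THEN **`rank₂ Cl(K_2) ≥ 2`** (so neither the depth door nor the pro-cyclic door — nor any «rank ≤ 1» conclusion — is
available; in `Λ`-terms `J` has no linear element: `μ₂ > 0` or `λ₂ ≥ 2`).  Proof on `Cl(K_2)[2^∞]` with `σ = γ|_{K_2}`: fixed part of order `≥ 4`, `(1+σ)`-quotient of order
`≥ 2^{e_1} ≥ 4` (Γ-equivariant norm onto `Cl(K_1)`, Neukirch (1.6)(iv), `2 ∤ h_K`), and §1. [cite: Washington1997, §13.3 Lemmas 13.15, 13.18 and Prop. 13.22]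
[cite: NeukirchANT1999, Ch. III §1 Prop. (1.6) (iv)] [cite: Lang1990, Ch. 5 §2] -/
theorem two_le_classGroupPRank_two_of_two_le_of_four_dvd (κ : ZpExtension K 2) (hκ : TotallyRamifiedFrom κ 0)
    (hK : ¬ 2 ∣ classNumber K) (he1 : 2 ≤ classNumberPExp κ 1)
    (hfix : 4 ∣ Nat.card {c : ClassGroup (𝓞 (κ.layer 2)) //
        ∀ τ : (κ.layer 2) ≃ₐ[K] (κ.layer 2), ClassGroup.mulEquiv (AmbiguousClass.intAut τ) c = c}) :
    2 ≤ classGroupPRank κ 2 := by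
  classical
  haveI : Fact (Nat.Prime 2) := ⟨Nat.prime_two⟩
  -- the layers `K_1 ⊆ K_2`
  haveI : FiniteDimensional K (κ.layer 1) := κ.finiteDimensional_layer_holds 1
  haveI : FiniteDimensional K (κ.layer 2) := κ.finiteDimensional_layer_holds 2
  haveI : NumberField (κ.layer 1) := NumberField.of_module_finite K _
  haveI : NumberField (κ.layer 2) := NumberField.of_module_finite K _
  haveI : IsGalois K (κ.layer 1) := κ.isGalois_layer_holds 1
  haveI : IsGalois K (κ.layer 2) := κ.isGalois_layer_holds 2
  haveI : Normal K (κ.layer 1) := IsGalois.to_normal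
  haveI : Normal K (κ.layer 2) := IsGalois.to_normal
  have h12 : κ.layer 1 ≤ κ.layer 2 := κ.layer_mono one_le_two
  letI : Algebra (κ.layer 1) (κ.layer 2) := (IntermediateField.inclusion h12).toRingHom.toAlgebra
  haveI : IsScalarTower K (κ.layer 1) (κ.layer 2) :=
    IsScalarTower.of_algebraMap_eq fun x => ((IntermediateField.inclusion h12).commutes x).symm
  -- a topological generator `γ`; `σ = γ|_{K_2}` (order `4`), `σ₁ = γ|_{K_1}` (order `2`)
  obtain ⟨γ, hγ⟩ : ∃ γ : absoluteGaloisGroup K, κ.IsTopGenerator γ := κ.surjective (Multiplicative.ofAdd 1)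
  set σ : (κ.layer 2) ≃ₐ[K] (κ.layer 2) := absRestrictNormalHom (κ.layer 2) γ with hσ
  set σ₁ : (κ.layer 1) ≃ₐ[K] (κ.layer 1) := absRestrictNormalHom (κ.layer 1) γ with hσ₁
  have hσgen : Subgroup.zpowers σ = ⊤ := zpowers_absRestrictNormalHom_layer_eq_top κ hγ 2
  have hσ₁ord : orderOf σ₁ = 2 := by
    rw [hσ₁, orderOf_absRestrictNormalHom_layer κ hγ 1]; norm_num
  -- `α = σ` on `Cl(K_2)`
  let α : ClassGroup (𝓞 (κ.layer 2)) ≃* ClassGroup (𝓞 (κ.layer 2)) := ClassGroup.mulEquiv (AmbiguousClass.intAut σ)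
  have hα : ∀ c, α c = ClassGroup.mulEquiv (AmbiguousClass.intAut σ) c := fun _ => rfl
  -- the `σ`-fixed classes are the `Gal(K_2/K)`-fixed classes
  have hfixα : 4 ∣ Nat.card {c : ClassGroup (𝓞 (κ.layer 2)) // α c = c} := by
    have hcard : Nat.card {c : ClassGroup (𝓞 (κ.layer 2)) //
        ∀ τ : (κ.layer 2) ≃ₐ[K] (κ.layer 2), ClassGroup.mulEquiv (AmbiguousClass.intAut τ) c = c} =
        Nat.card {c : ClassGroup (𝓞 (κ.layer 2)) // α c = c} := by
      refine Nat.card_congr (Equiv.subtypeEquivRight fun c => ⟨fun h => h σ, fun h τ => ?_⟩)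
      obtain ⟨k, rfl⟩ := Herbrand.exists_pow_eq_of_forall_mem_zpowers
        (fun τ' => by rw [hσgen]; exact Subgroup.mem_top τ') τ
      induction k with
      | zero => rw [pow_zero, AmbiguousClass.mulEquiv_intAut_one, MulEquiv.refl_apply]
      | succ k ih => rw [pow_succ, AmbiguousClass.mulEquiv_intAut_mul, MulEquiv.trans_apply, ← hα, h, ih]
    rwa [hcard] at hfix
  -- the norm `N : Cl(K_2) → Cl(K_1)`, onto
  set N := classGroupNorm (κ.layer 1) (κ.layer 2) with hN
  have hNsurj : Function.Surjective N := classGroupNorm_layer_succ_surjective κ 1 hκ (Nat.zero_le 1)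
  -- `4 ∣ #Cl(K_1)`
  have h4 : 4 ∣ Nat.card (ClassGroup (𝓞 (κ.layer 1))) := by
    have hne : Nat.card (ClassGroup (𝓞 (κ.layer 1))) ≠ 0 := Nat.card_pos.ne'
    have h : 2 ^ 2 ∣ Nat.card (ClassGroup (𝓞 (κ.layer 1))) := by
      rw [padicValNat_dvd_iff_le hne, ← classNumberPExp_def]; exact he1
    simpa using h
  -- `(1+σ)` kills into `ker N` on `2`-primary classes
  have hker : ∀ g : ClassGroup (𝓞 (κ.layer 2)), g ∈ CommGroup.primaryComponent (ClassGroup (𝓞 (κ.layer 2))) 2 →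
      N (g * α g) = 1 := by
    intro g hg
    obtain ⟨k, hk⟩ := (CommGroup.mem_primaryComponent).mp hg
    rw [map_mul, hα, hN, classGroupNorm_layer_layer_mulEquiv_intAut_absRestrictNormalHom κ γ g, ← hσ₁]
    set y := classGroupNorm (κ.layer 1) (κ.layer 2) g with hy
    -- `Gal(K_1/K) = {1, σ₁}`
    have hne1 : (1 : (κ.layer 1) ≃ₐ[K] (κ.layer 1)) ≠ σ₁ := by
      intro h1
      have : orderOf σ₁ = 1 := by rw [← h1, orderOf_one]
      rw [hσ₁ord] at this
      exact absurd this (by norm_num)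
    have huniv : ({1, σ₁} : Finset ((κ.layer 1) ≃ₐ[K] (κ.layer 1))) = Finset.univ := by
      refine Finset.eq_univ_of_card _ ?_
      rw [Finset.card_pair hne1, ← Nat.card_eq_fintype_card, IsGalois.card_aut_eq_finrank, κ.finrank_layer_holds 1, pow_one]
    have hprod : y * ClassGroup.mulEquiv (AmbiguousClass.intAut σ₁) y =
        ∏ τ : (κ.layer 1) ≃ₐ[K] (κ.layer 1), ClassGroup.mulEquiv (AmbiguousClass.intAut τ) y := by
      rw [← huniv, Finset.prod_pair hne1, AmbiguousClass.mulEquiv_intAut_one, MulEquiv.refl_apply]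
    rw [hprod, ← classGroupExtend_classGroupNorm_eq_prod K (κ.layer 1) y]
    -- `N_{K_1/K} y` is a `2`-primary class of `K`, hence trivial
    have hz : classGroupNorm K (κ.layer 1) y ^ 2 ^ k = 1 := by
      rw [← map_pow, hy, ← map_pow, hk, map_one, map_one]
    have h1 : classGroupNorm K (κ.layer 1) y = 1 := by
      have hdvd1 : orderOf (classGroupNorm K (κ.layer 1) y) ∣ 2 ^ k := orderOf_dvd_of_pow_eq_one hz
      have hdvd2 : orderOf (classGroupNorm K (κ.layer 1) y) ∣ classNumber K := orderOf_dvd_card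
      have hcop : Nat.Coprime (2 ^ k) (classNumber K) :=
        Nat.Coprime.pow_left k ((Nat.Prime.coprime_iff_not_dvd Nat.prime_two).mpr hK)
      have h := Nat.dvd_gcd hdvd1 hdvd2
      rw [hcop, Nat.dvd_one] at h
      exact orderOf_eq_one_iff.mp h
    rw [h1, map_one]
  -- the group-theoretic lemma, and the dictionary `#Cl(K_2)[2] = 2^{rank₂}`
  have h := natCard_sq_eq_one_four_le_of_four_dvd_card_fixed α hfixα N hNsurj h4 hker
  rw [natCard_torsion_classGroup_layer_eq κ 2] at h
  have h1 : 2 ^ 2 ≤ 2 ^ classGroupPRank κ 2 := by norm_num; exact h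
  exact (Nat.pow_le_pow_iff_right (by norm_num)).mp h1

end Door

/-! ## §4 Chevalley's currency: every unit of `K` a norm from `K_2` -/

section Chevalley

open Literature.NumberTheory.EllipticCurves Literature.NumberTheory.NumberFields Literature.NumberTheory.NumberFields.AmbiguousClass
  Literature.NumberTheory.GaloisRepresentations Literature.NumberTheory.GaloisRepresentations.Herbrand
  Literature.NumberTheory.GaloisRepresentations.MinkowskiUnit Literature.NumberTheory.GaloisRepresentations.CyclicNormIndex

variable {K : Type} [Field K] [NumberField K]

/-- ★★ **THE CONVERSE QUADRANT IN CHEVALLEY'S CURRENCY.**  `κ` a `ℤ₂`-extension of `K` with Fukuda index `0`, `2 ∤ h_K`, **`2 ≤ ord₂ h(K_1)`**, at least two primes of `K`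
ramified in `K_2`, and **`[E_K : E_K ∩ N_{K_2/K} K_2ˣ] = 1`** (every unit of `K` a norm from the quartic layer — the depth door's unit hypothesis; g42's
`four_dvd_card_fixed_layer_two`).  THEN `rank₂ Cl(K_2) ≥ 2`: the depth door needs `e_1 ≤ 1` and cannot be repaired on this class.
[cite: Lang1990, Ch. 13 §4, Lemma 4.1 (PDF pp. 203–204)] [cite: Washington1997, §13.3 Prop. 13.22] -/
theorem two_le_classGroupPRank_two_of_relIndex_unitsNorm_eq_one (κ : ZpExtension K 2) (hκ : TotallyRamifiedFrom κ 0)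
    (hK : ¬ 2 ∣ classNumber K) (he1 : 2 ≤ classNumberPExp κ 1) [NumberField (κ.layer 2)]
    (hs : 2 ≤ {v : HeightOneSpectrum (𝓞 K) | v.asIdeal.ramificationIdxIn (𝓞 (κ.layer 2)) ≠ 1}.ncard)
    (hidx : (unitsE (κ.layer 2) ⊓ (⊤ : Subgroup (κ.layer 2)ˣ).map
        (Herbrand.norm ((κ.layer 2) ≃ₐ[K] (κ.layer 2)))).relIndex
        (unitsE (κ.layer 2) ⊓ (unitsIncl K (κ.layer 2)).range) = 1) :
    2 ≤ classGroupPRank κ 2 :=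
  two_le_classGroupPRank_two_of_two_le_of_four_dvd κ hκ hK he1 (four_dvd_card_fixed_layer_two κ hκ hs hidx)

/-- ★★ **The converse quadrant for an odd-degree field whose dyadic primes have odd `e(w|2)`** (e.g. `2 ∤ d_K`), `κ` cyclotomic, at least two primes above `2`:
`2 ∤ h_K`, `2 ≤ ord₂ h(K_1)` and every unit of `K` a norm from `K_2` ⟹ `rank₂ Cl(K_2) ≥ 2`.  (Cell reading: complex cubic `F`, `Δ_W ≡ 5 (8)`: the class `t ≥ 4 ∧ e_1 ≥ 2`.)
[cite: Lang1990, Ch. 13 §4, Lemma 4.1] [cite: Washington1997, §13.1 Prop. 13.2 and §13.3 Prop. 13.22] -/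
theorem two_le_classGroupPRank_two_of_relIndex_unitsNorm_eq_one_of_forall_odd_ramificationIdx (hK : ¬ 2 ∣ Module.finrank ℚ K)
    (κ : ZpExtension K 2) (hκ : κ.IsCyclotomic)
    (hodd : ∀ w : HeightOneSpectrum (𝓞 K), ((2 : ℕ) : 𝓞 K) ∈ w.asIdeal → Odd (w.asIdeal.ramificationIdx ℤ))
    (hh : ¬ 2 ∣ classNumber K) (he1 : 2 ≤ classNumberPExp κ 1)
    (h2 : 2 ≤ {w : HeightOneSpectrum (𝓞 K) | ((2 : ℕ) : 𝓞 K) ∈ w.asIdeal}.ncard) [NumberField (κ.layer 2)]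
    (hidx : (unitsE (κ.layer 2) ⊓ (⊤ : Subgroup (κ.layer 2)ˣ).map
        (Herbrand.norm ((κ.layer 2) ≃ₐ[K] (κ.layer 2)))).relIndex
        (unitsE (κ.layer 2) ⊓ (unitsIncl K (κ.layer 2)).range) = 1) :
    2 ≤ classGroupPRank κ 2 :=
  two_le_classGroupPRank_two_of_relIndex_unitsNorm_eq_one κ (totallyRamifiedFrom_zero_of_forall_odd_ramificationIdx hK κ hκ hodd) hh he1
    (h2.trans (ncard_dyadic_le_ncard_ramified_layer hK κ hκ hodd (by norm_num : 1 ≤ 2))) hidx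

end Chevalley

end Literature.NumberTheory.IwasawaTheory

end
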